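import Summits.CriticalPhenomena.PercolationContinuityZ3.Theorems.Transplant.Slab111HubEntry
import HarnessLib

/-!
# The HUB ROUTING of the `(111)`-films, VIII: placing the hub ZONE in a gap of the level order, and the exclusion bits

builds on p205010 (kernel theorem, internal audit signed; external expert review pending) — NOT used in this file.  Lane `prim-bschramm`, seat
`prim-bschramm-p2` (gen 36; class C1b; memo `HOME/bschramm/P2-LATTICES.md` §130); helper file (`--supports stmt-CriticalPhenomena-4575 --as helper`).
The arithmetic the per-shape dispatchers share when they apply «Slab111HubEntry».`Entry.swap`:
* §1 **`zone_exists`**: for `k ≥ 6Λ + 33` and any three levels in `[0, k]` there is a hub zone — a lower hub level `Hlo ≡ c0 (mod 3)` with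
  `2 ≤ Hlo`, `Hlo + 3 ≤ k − 2` — such that every terminal is at distance `≥ Λ + 2` below the zone or above it (one of the four gaps of the level
  order is long enough);
* §2 the hub levels `LA, LD` from `Hlo` and the direction of `E₁` (`laOf`, `ldOf` and their facts);
* §3 the EXCLUSION BITS `xb` ("terminal `J` lies between terminal `I` and the zone") and **`sep_of_xb`**: for level-far terminals, either the bit is
  set or `J` is beyond `I` / beyond the zone — the `sIJ` hypotheses of `Entry.swap`.
[cite: DuminilCopinSidoraviciusTassion2016, §2.3 (proof of Fact 2: the three disjoint paths γ_u, γ_v, γ_w in B_R(z))]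
-/

noncomputable section

namespace Summit.CriticalPhenomena.PercolationContinuityZ3.Theorems.Transplant

open Literature.Probability.Percolation Literature.Probability.LatticeModels SimpleGraph
open scoped Classical

namespace Slab111

/-! ## §1 A zone in a gap -/

/-- The least level `≥ x` of class `c0`. [folklore] -/
def alignUp (c0 x : ℤ) : ℤ := x + (c0 - x) % 3

/-- `alignUp c0 x ≡ c0`, and `x ≤ alignUp c0 x ≤ x + 2`. [folklore] -/
theorem alignUp_spec (c0 x : ℤ) : (3 : ℤ) ∣ alignUp c0 x - c0 ∧ x ≤ alignUp c0 x ∧ alignUp c0 x ≤ x + 2 := by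
  unfold alignUp
  refine ⟨by omega, by omega, by omega⟩

/-- A terminal at level `n` clears the zone `[Hlo − 1, Hlo + 4]` with margin `Λ`: it is below or above. [folklore] -/
def Clears (Λ Hlo n : ℤ) : Prop := n + Λ + 2 ≤ Hlo ∨ Hlo + Λ + 5 ≤ n

/-- **A ZONE EXISTS IN SOME GAP** when `k ≥ 6Λ + 33`. [folklore] -/
theorem zone_exists (c0 : ℤ) {k : ℕ} {Λ : ℤ} (hΛ : 0 ≤ Λ) (hk : 6 * Λ + 33 ≤ (k : ℤ)) {n₁ n₂ n₃ : ℤ}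
    (h1 : 0 ≤ n₁ ∧ n₁ ≤ k) (h2 : 0 ≤ n₂ ∧ n₂ ≤ k) (h3 : 0 ≤ n₃ ∧ n₃ ≤ k) :
    ∃ Hlo : ℤ, (3 : ℤ) ∣ Hlo - c0 ∧ 2 ≤ Hlo ∧ Hlo + 3 ≤ (k : ℤ) - 2 ∧ Clears Λ Hlo n₁ ∧ Clears Λ Hlo n₂ ∧ Clears Λ Hlo n₃ := by
  -- candidates: just above the bottom, or just above one of the terminals
  obtain ⟨d0, a0, b0⟩ := alignUp_spec c0 2
  obtain ⟨d1, a1, b1⟩ := alignUp_spec c0 (n₁ + Λ + 2)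
  obtain ⟨d2, a2, b2⟩ := alignUp_spec c0 (n₂ + Λ + 2)
  obtain ⟨d3, a3, b3⟩ := alignUp_spec c0 (n₃ + Λ + 2)
  unfold Clears
  by_cases c0ok : alignUp c0 2 + Λ + 5 ≤ n₁ ∧ alignUp c0 2 + Λ + 5 ≤ n₂ ∧ alignUp c0 2 + Λ + 5 ≤ n₃
  · exact ⟨alignUp c0 2, d0, by omega, by omega, Or.inr c0ok.1, Or.inr c0ok.2.1, Or.inr c0ok.2.2⟩
  by_cases c1ok : alignUp c0 (n₁ + Λ + 2) + 3 ≤ (k : ℤ) - 2 ∧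
      (n₂ + Λ + 2 ≤ alignUp c0 (n₁ + Λ + 2) ∨ alignUp c0 (n₁ + Λ + 2) + Λ + 5 ≤ n₂) ∧
      (n₃ + Λ + 2 ≤ alignUp c0 (n₁ + Λ + 2) ∨ alignUp c0 (n₁ + Λ + 2) + Λ + 5 ≤ n₃)
  · exact ⟨alignUp c0 (n₁ + Λ + 2), d1, by omega, c1ok.1, Or.inl (by omega), c1ok.2.1, c1ok.2.2⟩
  by_cases c2ok : alignUp c0 (n₂ + Λ + 2) + 3 ≤ (k : ℤ) - 2 ∧
      (n₁ + Λ + 2 ≤ alignUp c0 (n₂ + Λ + 2) ∨ alignUp c0 (n₂ + Λ + 2) + Λ + 5 ≤ n₁) ∧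
      (n₃ + Λ + 2 ≤ alignUp c0 (n₂ + Λ + 2) ∨ alignUp c0 (n₂ + Λ + 2) + Λ + 5 ≤ n₃)
  · exact ⟨alignUp c0 (n₂ + Λ + 2), d2, by omega, c2ok.1, c2ok.2.1, Or.inl (by omega), c2ok.2.2⟩
  by_cases c3ok : alignUp c0 (n₃ + Λ + 2) + 3 ≤ (k : ℤ) - 2 ∧
      (n₁ + Λ + 2 ≤ alignUp c0 (n₃ + Λ + 2) ∨ alignUp c0 (n₃ + Λ + 2) + Λ + 5 ≤ n₁) ∧
      (n₂ + Λ + 2 ≤ alignUp c0 (n₃ + Λ + 2) ∨ alignUp c0 (n₃ + Λ + 2) + Λ + 5 ≤ n₂)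
  · exact ⟨alignUp c0 (n₃ + Λ + 2), d3, by omega, c3ok.1, c3ok.2.1, c3ok.2.2, Or.inl (by omega)⟩
  -- otherwise all four gaps are short, contradicting `k ≥ 6Λ + 33`
  exfalso
  omega

/-! ## §2 The hub levels from the zone and the direction of `E₁` -/

/-- The hub adjacent to `c`: the lower hub if `E₁` is below the zone (`dir₁ = 1`), else the upper one. [folklore] -/
def laOf (Hlo dir₁ : ℤ) : ℤ := if dir₁ = 1 then Hlo else Hlo + 3

/-- The other hub. [folklore] -/
def ldOf (Hlo dir₁ : ℤ) : ℤ := if dir₁ = 1 then Hlo + 3 else Hlo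

/-- Facts about `laOf`, `ldOf`. [folklore] -/
theorem laOf_spec {c0 Hlo dir₁ : ℤ} (hH : (3 : ℤ) ∣ Hlo - c0) (hd : dir₁ = 1 ∨ dir₁ = -1) :
    (3 : ℤ) ∣ laOf Hlo dir₁ - c0 ∧ ldOf Hlo dir₁ = laOf Hlo dir₁ + 3 * dir₁ ∧ min (laOf Hlo dir₁) (ldOf Hlo dir₁) = Hlo ∧
      max (laOf Hlo dir₁) (ldOf Hlo dir₁) = Hlo + 3 := by
  unfold laOf ldOf
  rcases hd with h | h
  · simp only [h, if_true]
    exact ⟨hH, by ring, min_eq_left (show Hlo ≤ Hlo + 3 by omega), max_eq_right (show Hlo ≤ Hlo + 3 by omega)⟩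
  · have hne : dir₁ ≠ 1 := by omega
    simp only [hne, if_false]
    refine ⟨?_, by rw [h]; ring, min_eq_right (show Hlo ≤ Hlo + 3 by omega), max_eq_left (show Hlo ≤ Hlo + 3 by omega)⟩
    have : Hlo + 3 - c0 = (Hlo - c0) + 3 := by ring
    rw [this]; exact dvd_add hH (dvd_refl 3)

/-! ## §3 Exclusion bits -/

/-- The direction of a terminal towards the zone: `+1` if it is below (`n + Λ + 2 ≤ Hlo`), else `−1`. [folklore] -/
def dirOfLevel (Λ Hlo n : ℤ) : ℤ := if n + Λ + 2 ≤ Hlo then 1 else -1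

/-- `dirOfLevel` is `±1`. [folklore] -/
theorem dirOfLevel_eq (Λ Hlo n : ℤ) : dirOfLevel Λ Hlo n = 1 ∨ dirOfLevel Λ Hlo n = -1 := by
  unfold dirOfLevel; split_ifs <;> simp

/-- The zone-margin facts in the form `Entry.swap` wants. [folklore] -/
theorem dir_margin {Λ Hlo n : ℤ} (hc : Clears Λ Hlo n) :
    (dirOfLevel Λ Hlo n = 1 → n + Λ + 2 ≤ Hlo) ∧ (dirOfLevel Λ Hlo n = -1 → Hlo + 3 + Λ + 2 ≤ n) := by
  unfold dirOfLevel Clears at *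
  split_ifs with h
  · exact ⟨fun _ => h, fun h' => by norm_num at h'⟩
  · exact ⟨fun h' => by norm_num at h', fun _ => by omega⟩

/-- **The exclusion bit**: terminal `J` (level `nJ`) lies between terminal `I` (level `nI`) and the zone — same side, and closer. [folklore] -/
def xb (Λ Hlo nI nJ : ℤ) : Bool :=
  (dirOfLevel Λ Hlo nI == dirOfLevel Λ Hlo nJ) && (if dirOfLevel Λ Hlo nI = 1 then decide (nI < nJ) else decide (nJ < nI))

/-- **Separation from the bit**: for level-far terminals clearing the zone, either `J` is between `I` and the zone (bit set) or `J` is beyond `I` /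
beyond the zone with slack `Λ` — the `sIJ` hypothesis of `Entry.swap` (rewrite `min LA LD = Hlo`, `max LA LD = Hlo + 3` first, `laOf_spec`). [folklore] -/
theorem sep_of_xb {Λ Hlo nI nJ : ℤ} (hΛ : 0 ≤ Λ) (hJ : Clears Λ Hlo nJ) (hfar : nI + 2 * Λ < nJ ∨ nJ + 2 * Λ < nI) :
    xb Λ Hlo nI nJ = true ∨ nJ + Λ < min (nI - Λ) (Hlo - 1) ∨ max (nI + Λ) (Hlo + 3 + 1) < nJ - Λ := by
  unfold xb dirOfLevel Clears at *
  by_cases hi : nI + Λ + 2 ≤ Hlo <;> by_cases hj : nJ + Λ + 2 ≤ Hlo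
  · -- both below
    rcases lt_or_ge nI nJ with h | h
    · left; simp [hi, hj, h]
    · right; left; rw [lt_min_iff]; constructor <;> omega
  · -- I below, J above
    right; right; rw [max_lt_iff]; constructor <;> omega
  · -- I above, J below
    right; left; rw [lt_min_iff]; constructor <;> omega
  · -- both above
    rcases lt_or_ge nJ nI with h | h
    · left; simp [hi, hj, h]
    · right; right; rw [max_lt_iff]; constructor <;> omega

end Slab111

end Summit.CriticalPhenomena.PercolationContinuityZ3.Theorems.Transplant

end
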